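/-
Copyright (c) 2026 the pub-hodgecm-mathlib formalisation cell (harness21).  Prover seat hodgecm-mathlib-F0P3a-p04 (g16), 2026-09-01.  Road «S3-tree» (architect A-p16 (g29) A-80 (3)),
brick T3′ «depth-zero κ-transfer», population (P-3) LEVI: organ L-α2a «HEISENBERG STRATA IN COORDINATES» — the Heisenberg reading of ★ L-α1 `UnitriangularResidualRankStrata`
(p846209); census `F0/P3a/F0P3a-p04/g16/CENSUS-T3prime-P3.F0P3a-p04g16.md` §0 (iv), §1 L-α.
-/
import Literature.NumberTheory.Automorphic.UnitriangularResidualRankStrata      -- ★ L-α1 (this seat): `rank_redMat_unitriangular_sub_one_eq_two ∕ _one ∕ _zero`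
import Literature.NumberTheory.Automorphic.UnitaryGroupHeisenbergRing            -- ★ `HeisRing.heisMatrix σ x y = !![1, x, heisZ σ x y; 0, 1, -σ x; 0, 0, 1]`, `heisZ`
import HarnessLib

/-!
# The Jordan rank strata of the Heisenberg chart: `rank(red(u(x, z)) − 1) = 2 ⟺ |x| = 1`, `= 1 ⟺ |x| < 1 = |y|`, `= 0 ⟺ |x|, |y| < 1`

Topic `NumberTheory/Automorphic`; namespace `Literature.NumberTheory.Automorphic.UnitaryGroup.HeisRing` (continues ★ `UnitaryGroupHeisenbergRing`).  THEOREMS ONLY (no definition, no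
instance, no notation, no named fact, no `sorry`); any valued field `[Field K] [ValuativeRel K]` with an ISOMETRIC ring endomorphism `σ` (`|σ x| = |x|`) and `|2| = 1` (odd residue
characteristic), ★ `IntegralReduction` currency.  Cell `pub/hodgecm-mathlib`, crux H413 = `stmt-HodgeConjecture-24833`; road «S3-tree», brick T3′ (HEAD v4 clause
`depthZeroKappaTransfer_hyperspecial_levi`, DESIGN v2 §2 (P-3)).  HONEST LABEL: HC_CM is proved only modulo the cell's 2 remaining named inputs (hLiu418 24832, h413 24833) until
rung 0 closes; this file is elementary valuation algebra and asserts nothing printed.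

THE MATHEMATICS.  The unipotent radical `N` of the Borel subgroup of `U(Φ₃)(L⁺_v)` has the Heisenberg chart ★ `heisMatrix σ x y = u(x, z) = [[1, x, z], [0, 1, −σx], [0, 0, 1]]`,
`z = heisZ σ x y = y − ½·x·σx` ([Rogawski1990, §1.10]).  At the place `w` (`K = L_w`, `σ = σ_w` isometric, `|2|_w = 1`), for `|x| ≤ 1`, `|y| ≤ 1`:
* `u(x, z)` is INTEGRAL iff `|x| ≤ 1 ∧ |y| ≤ 1` (`|z − y| = |½·x·σx| ≤ |x|² ≤ 1`): `valuation_heisZ_le_one`;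
* the residual matrix `red u(x,z) − 1 = S(x̄, z̄, −σ̄x̄)` (★ L-α1 `redMat_unitriangular_sub_one`) has the entries `a = x`, `c = −σx` of the SAME valuation `|x|`, so ★ L-α1's three
  strata (which ask `|a| = |c| = 1`, resp. `|a|, |c| < 1` — the mixed profiles of ref5's R-65 note never occur here) read:
  **`|x| = 1 ⇒ rank 2`** (`rank_redMat_heisMatrix_sub_one_eq_two`); **`|x| < 1`, `|y| = 1 ⇒ rank 1`** (then `|z| = |y| = 1` since `|z − y| < 1`: `valuation_heisZ_eq_of_lt`);
  **`|x| < 1`, `|y| < 1 ⇒ rank 0`** (`|z| < 1`).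
With the residue counts of [Flicker1998UnitaryFL, §2] (`x ∈ 𝔽_{q²}`, `y` on the skew line `𝔽_q·δ̄`) these are the strata of sizes `q³ − q`, `q − 1`, `1` of `N(𝔽_q)` behind ★ p846176
`depthZero_matrix_identity_levi`; the Haar-volume reading (`1 − q⁻²`, `q⁻²(1 − q⁻¹)`, `q⁻³` of `μ_N(N(𝒪))`) is the sequel L-α2b.

* §1 `valuation_invOf_two_eq_one`, `valuation_heisZ_sub_le`, `valuation_heisZ_le_one`, `valuation_heisZ_eq_of_lt`, `valuation_heisZ_lt_one`, `valuation_neg_map_eq`.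
* §2 **`rank_redMat_heisMatrix_sub_one_eq_two`**, **`…_eq_one`**, **`…_eq_zero`**, and the trichotomy packaging `rank_redMat_heisMatrix_sub_one_eq_ite`.

## References
* [Rogawski1990] J. D. Rogawski, *Automorphic Representations of Unitary Groups in Three Variables* (1990), §1.10 p. 9 (`N = {u(x, z) : x x̄ = z + z̄}`), §4.9 p. 54.
* [Flicker1998UnitaryFL] Y. Z. Flicker, *Elementary proof of the fundamental lemma for a unitary group*, Canad. J. Math. 50 (1998), §2 (the Heisenberg group and its filtration).
* [HornJohnson2013] R. A. Horn, C. R. Johnson, *Matrix Analysis*, 2nd ed. (2013), §3.2 Problem 3.2.P27.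
-/

set_option autoImplicit false

open Matrix ValuativeRel
open scoped ValuativeRel

namespace Literature.NumberTheory.Automorphic.UnitaryGroup.HeisRing

open Literature.NumberTheory.Automorphic Literature.NumberTheory.Automorphic.IntegralReduction

variable {K : Type*} [Field K] [ValuativeRel K] (σ : K →+* K) [Invertible (2 : K)]
  (hσv : ∀ x, valuation K (σ x) = valuation K x) (h2 : valuation K (2 : K) = 1)

/-! ## §1 Valuation bookkeeping of the `z`-entry `z = y − ½ x σx` -/

include h2 in
/-- `|½| = 1` when `|2| = 1`. [cite: Rogawski1990, §1.10 p. 9] -/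
theorem valuation_invOf_two_eq_one : valuation K (⅟(2 : K)) = 1 := by
  have h : valuation K (⅟(2 : K)) * valuation K (2 : K) = 1 := by
    rw [← Valuation.map_mul, invOf_mul_self, Valuation.map_one]
  rwa [h2, mul_one] at h

include hσv h2 in
/-- `|z − y| = |½ x σx| ≤ |x|²` — precisely `= |x|·|x|`. [cite: Rogawski1990, §1.10 p. 9] -/
theorem valuation_heisZ_sub_le (x y : K) : valuation K (heisZ σ x y - y) = valuation K x * valuation K x := by
  rw [heisZ, show y - ⅟(2 : K) * (x * σ x) - y = -(⅟(2 : K) * (x * σ x)) by ring, Valuation.map_neg, Valuation.map_mul, Valuation.map_mul,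
    valuation_invOf_two_eq_one h2, one_mul, hσv]

include hσv h2 in
/-- **INTEGRALITY of the chart**: for `|x| ≤ 1`, `|z| ≤ 1 ⟺ |y| ≤ 1`. [cite: Rogawski1990, §1.10 p. 9] -/
theorem valuation_heisZ_le_one {x : K} (hx : valuation K x ≤ 1) (y : K) : valuation K (heisZ σ x y) ≤ 1 ↔ valuation K y ≤ 1 := by
  have hd : valuation K (heisZ σ x y - y) ≤ 1 := by
    rw [valuation_heisZ_sub_le σ hσv h2]
    calc valuation K x * valuation K x ≤ 1 * 1 := mul_le_mul' hx hx
      _ = 1 := mul_one _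
  constructor
  · intro hz
    have h := Valuation.map_sub (valuation K) (heisZ σ x y) (heisZ σ x y - y)
    rw [show heisZ σ x y - (heisZ σ x y - y) = y by ring] at h
    exact h.trans (max_le hz hd)
  · intro hy
    have h := Valuation.map_add (valuation K) (heisZ σ x y - y) y
    rw [show heisZ σ x y - y + y = heisZ σ x y by ring] at h
    exact h.trans (max_le hd hy)

include hσv h2 in
/-- For `|x| < 1`: `|z| = |y|` whenever `|y| = 1` (the correction `½xσx` is in `𝔪`). [cite: Rogawski1990, §1.10 p. 9] -/
theorem valuation_heisZ_eq_of_lt {x y : K} (hx : valuation K x < 1) (hy : valuation K y = 1) : valuation K (heisZ σ x y) = 1 := by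
  have hd : valuation K (heisZ σ x y - y) < 1 := by
    rw [valuation_heisZ_sub_le σ hσv h2]
    calc valuation K x * valuation K x ≤ valuation K x * 1 := mul_le_mul' le_rfl hx.le
      _ = valuation K x := mul_one _
      _ < 1 := hx
  have hlt : valuation K (heisZ σ x y - y) < valuation K y := by rw [hy]; exact hd
  have h := Valuation.map_add_eq_of_lt_left (valuation K) hlt
  rw [show y + (heisZ σ x y - y) = heisZ σ x y by ring] at h
  rw [h, hy]

include hσv h2 in
/-- For `|x| < 1` and `|y| < 1`: `|z| < 1`. [cite: Rogawski1990, §1.10 p. 9] -/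
theorem valuation_heisZ_lt_one {x y : K} (hx : valuation K x < 1) (hy : valuation K y < 1) : valuation K (heisZ σ x y) < 1 := by
  have hd : valuation K (heisZ σ x y - y) < 1 := by
    rw [valuation_heisZ_sub_le σ hσv h2]
    calc valuation K x * valuation K x ≤ valuation K x * 1 := mul_le_mul' le_rfl hx.le
      _ = valuation K x := mul_one _
      _ < 1 := hx
  have h := Valuation.map_add (valuation K) (heisZ σ x y - y) y
  rw [show heisZ σ x y - y + y = heisZ σ x y by ring] at h
  exact lt_of_le_of_lt h (max_lt hd hy)

omit [Invertible (2 : K)] in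
include hσv in
/-- `|−σx| = |x|`. [cite: Rogawski1990, §1.10 p. 9] -/
theorem valuation_neg_map_eq (x : K) : valuation K (-σ x) = valuation K x := by
  rw [Valuation.map_neg, hσv]

/-! ## §2 The three strata of `red u(x, z) − 1` -/

include hσv in
/-- **RANK 2 STRATUM: `|x| = 1` ⇒ `rank(red(heisMatrix σ x y) − 1) = 2`** (`|y| ≤ 1`). [cite: HornJohnson2013, §3.2 Problem 3.2.P27] [cite: Flicker1998UnitaryFL, §2] -/
theorem rank_redMat_heisMatrix_sub_one_eq_two {x : K} (hx : valuation K x = 1) (y : K) : (redMat (heisMatrix σ x y) - 1).rank = 2 := by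
  unfold heisMatrix
  exact rank_redMat_unitriangular_sub_one_eq_two hx (by rw [valuation_neg_map_eq σ hσv, hx])

include hσv h2 in
/-- **RANK 1 STRATUM: `|x| < 1`, `|y| = 1` ⇒ `rank(red(heisMatrix σ x y) − 1) = 1`.** [cite: HornJohnson2013, §3.2 Problem 3.2.P27] [cite: Flicker1998UnitaryFL, §2] -/
theorem rank_redMat_heisMatrix_sub_one_eq_one {x y : K} (hx : valuation K x < 1) (hy : valuation K y = 1) : (redMat (heisMatrix σ x y) - 1).rank = 1 := by
  unfold heisMatrix
  exact rank_redMat_unitriangular_sub_one_eq_one hx (valuation_heisZ_eq_of_lt σ hσv h2 hx hy) (by rw [valuation_neg_map_eq σ hσv]; exact hx)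

include hσv h2 in
/-- **RANK 0 STRATUM: `|x| < 1`, `|y| < 1` ⇒ `rank(red(heisMatrix σ x y) − 1) = 0`.** [cite: HornJohnson2013, §0.4] [cite: Flicker1998UnitaryFL, §2] -/
theorem rank_redMat_heisMatrix_sub_one_eq_zero {x y : K} (hx : valuation K x < 1) (hy : valuation K y < 1) : (redMat (heisMatrix σ x y) - 1).rank = 0 := by
  unfold heisMatrix
  exact rank_redMat_unitriangular_sub_one_eq_zero hx (valuation_heisZ_lt_one σ hσv h2 hx hy) (by rw [valuation_neg_map_eq σ hσv]; exact hx)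

include hσv h2 in
/-- **THE TRICHOTOMY, PACKAGED**: for integral coordinates `|x| ≤ 1`, `|y| ≤ 1` the Jordan rank of `red(heisMatrix σ x y) − 1` is `2`, `1`, `0` according as `|x| = 1`;
`|x| < 1 = |y|`; `|x|, |y| < 1` — the value a depth-zero piece `c(rank)` takes on `u(x, z)`. [cite: Rogawski1990, §4.9 p. 54] [cite: Flicker1998UnitaryFL, §2] -/
theorem rank_redMat_heisMatrix_sub_one_eq_ite {x y : K} (hx : valuation K x ≤ 1) (hy : valuation K y ≤ 1) [Decidable (valuation K x = 1)]
    [Decidable (valuation K y = 1)] :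
    (redMat (heisMatrix σ x y) - 1).rank = if valuation K x = 1 then 2 else if valuation K y = 1 then 1 else 0 := by
  by_cases hx1 : valuation K x = 1
  · rw [if_pos hx1]; exact rank_redMat_heisMatrix_sub_one_eq_two σ hσv hx1 y
  · rw [if_neg hx1]
    have hxlt : valuation K x < 1 := lt_of_le_of_ne hx hx1
    by_cases hy1 : valuation K y = 1
    · rw [if_pos hy1]; exact rank_redMat_heisMatrix_sub_one_eq_one σ hσv h2 hxlt hy1
    · rw [if_neg hy1]; exact rank_redMat_heisMatrix_sub_one_eq_zero σ hσv h2 hxlt (lt_of_le_of_ne hy hy1)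

end Literature.NumberTheory.Automorphic.UnitaryGroup.HeisRing
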